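import Literature.Geometry.Kaehler.ComplexTorusMiddleHodgeLatticeIsometryExtension
import Literature.Geometry.Kaehler.ComplexTorusIntegralHodgeClassesRank
import Literature.Geometry.Kaehler.ComplexTorusTranscendentalLatticeInvariance
import HarnessLib

/-!
# The middle Hodge lattice `Hdgᵖ(X, ℤ) ⊂ H²ᵖ(X, ℤ)` and its transcendental complement `T` are isomorphism invariants of a
# complex torus of dimension `2p`; automorphisms act on `(H²ᵖ(X, ℤ), ⟨·,·⟩)` by isometries preserving `Hdg` and `T`, with
# Nikulin-compatible actions on the discriminant groups

Layer `Literature/Geometry/Kaehler`, namespace `Literature.Geometry.Kaehler.ComplexTorus`; lane `lit-hodgefound` (Track 2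
foundations library), seat p09, generation 31, row g31-#3. THEOREMS ONLY (0 definitions); no named fact, net debt 0. Sequel of
g30-#4 `ComplexTorusMiddleHodgeLatticeDiscriminant` / g30-#5 `ComplexTorusMiddleHodgeLatticeIsometryExtension` (carriers: for a torus
`X = E/Φ(ℤ^ι)` of dimension `g = 2p` with orientation `e : Fin 2g ≃ ι`, `H := H^{2p}(X, ℤ) = integralForms Φ (2p)` with the
cup form `B`, `↑(B x y) = ⟨x, y⟩_e` (hypothesis `hB`), `Hdg := Hdgᵖ(X, ℤ) ⊂ H` as
`AddSubgroup.toIntSubmodule ((integralHodgeClasses Φ p).addSubgroupOf (integralForms Φ (2 * p)))`, `T := B.orthogonal Hdg`) and of seat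
p18's `ComplexTorusTranscendentalLatticeInvariance` (the case `p = 1`: Shioda–Mitani's "`X ↦ T_X` is well defined on isomorphism
classes"), whose transport lemmas along `ρ(A)` for an integer matrix `A` with integer inverse `A′` and `ℂ`-linear `ρ(A)`, `ρ(A′)` — the
shape of every isomorphism of complex tori (`IsIsomorphic.exists_matrix_smul`, Lange Prop. 1.1.6 / Exercise 1.1.6 (5)(b)) — are consumed
BY NAME (`comp_realRep_mem_integralForms`, `comp_realRep_mem_integralHodgeClasses`, `compContinuousLinearMap_realRep_realRep`,
`map_pullbackAlt_integralForms_eq`, `map_pullbackAlt_integralHodgeClasses_eq`, `torusIntegral_comp_realRep_wedge`).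

* §1 TWO TORI `X`, `X′` of dimension `2p`, `f = ρ(A) : X ⥲ X′`: **`⟨f^*x, f^*y⟩_e = ε · ⟨x, y⟩_{e′}`, `ε = sign(e) sign(e′) = ±1`** (the
  cup product is transported isometrically, `∫_X f^*x ∧ f^*y = ∫_{X′} x ∧ y`, Shioda–Mitani (1.5); the sign only records the two
  chosen orientations), **`f^* T_{X′} ⊆ T_X`** and **`f^* T_{X′} = T_X`** (with `f^* Hdgᵖ(X′, ℤ) = Hdgᵖ(X, ℤ)`, p18).
* §2 **`IsIsomorphic X X′ ⟹` a `ℂ`-linear injective `Ψ = f^* : H^{2p}(X′, ℂ) → H^{2p}(X, ℂ)` with `Ψ H^{2p}(X′, ℤ) = H^{2p}(X, ℤ)`,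
  `Ψ Hdgᵖ(X′, ℤ) = Hdgᵖ(X, ℤ)`, `Ψ T_{X′} = T_X`, `∫_X Ψx ∧ Ψy = ∫_{X′} x ∧ y`, `⟨Ψx, Ψy⟩_e = ε ⟨x, y⟩_{e′}`** — Shioda–Mitani's
  map `g : X ↦ T_X` of (3.19) is well defined in EVERY codimension; `rk T_X = rk T_{X′}`.
* §3 ONE TORUS, `f = ρ(A) ∈ Aut(X)` (`A ∈ GL(Λ)`, `ρ(A)`, `ρ(A⁻¹)` `ℂ`-linear): **`f^*` is an ISOMETRY `G` of the lattice
  `(H^{2p}(X, ℤ), B)`** (`ε = sign(e)² = 1`) **with `G(Hdg) = Hdg`, `G(T) = T`**; it restricts to isometries `α` of `Hdg` and `β` of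
  `T`, and (Nikulin Cor. 1.5.2 / Kondō Prop. 2.11, through g30-#5's `exists_isometryEquiv_middle_extends_iff`) **the induced
  automorphisms of the discriminant groups are compatible with Kondō's `γ = p_T ∘ p_S⁻¹ : A_{Hdg} ⥲ A_T`: `γ ∘ ᾱ = β̄ ∘ γ`** (stated
  when `B|_{Hdg}` is non-degenerate, automatic on abelian varieties). Huybrechts Ch. 14 §0.2: an isometry of an overlattice
  preserving `Λ₁` and `Λ₂ = Λ₁^⊥` induces compatible isometries of `A_{Λ₁} ≅ A_{Λ₂}` — here for the action of `Aut(X)` on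
  `H^{2p}(X, ℤ) ⊃ Hdgᵖ(X, ℤ) ⊕ T`.

## The sources, verbatim

* T. Shioda, N. Mitani, *Singular abelian surfaces and binary quadratic forms*, LNM 412 (1974) [ShiodaMitani1974], §1 (1.5) (the cup
  product `H²(X, ℤ) × H²(X, ℤ) → H⁴(X, ℤ) = ℤ` "with respect to the natural orientation of `X` as a complex manifold"; "Let `T_X` denote
  the orthogonal complement of `S_X` in `H_X` […] the group of transcendental cocycles of `X`"), §3 (3.19) ("`f`, `g` are the maps
  induced by the maps `Q ⟶ A_Q` and `X ⟶ T_X`" — `g` lives on isomorphism classes).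
* H. Lange, *Abelian Varieties over the Complex Numbers* (Springer 2023) [Lange2023AbelianVarietiesComplex]: §1.1.2 Prop. 1.1.6 and
  §1.1.6 Exercise (5)(b) (isomorphisms of tori are the `ρ(A)`, `A ∈ GL(Λ, Λ′)`, with `ℂ`-linear analytic representation); §1.1.3
  Exercise 1.1.6 (7) (`f^*` on `H•(X, ℤ)`); §1.7.2 Cor. 1.7.6 (proof: `∫_Y f^*ω = (Λ : ρ_r(f)Λ′) ∫_X ω`); §6.2.4 p. 310; §7.2.2.
* D. Huybrechts, *Lectures on K3 Surfaces* (CUP 2016) [Huybrechts2016K3], Ch. 14 §0.2 (PDF pp. 333–334) (primitive `Λ₁ ⊂ Λ`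
  unimodular, `Λ₂ = Λ₁^⊥`, `A_{Λ₁} ≅ A_{Λ₂}`; Prop. 0.2 (ii): isometries of `Λ₁`, `Λ₂` glue iff compatible on the discriminant groups);
  Ch. 3 §2.2–2.3 (the transcendental lattice of tori and its functoriality).
* V. V. Nikulin (1980) [Nikulin1980], Cor. 1.5.2, Prop. 1.6.1; S. Kondō (2013) [Kondo2013K3Enriques], §2.10 Prop. 2.11, Cor. 2.14
  (PDF pp. 128–129) — through g30-#5's `exists_isometryEquiv_middle_extends_iff`.

## Contents (theorems only)

* §1 **`poincarePairing_comp_realRep_of_mul_eq_one`** (`⟨f^*x, f^*y⟩_e = sign(e)sign(e′) ⟨x, y⟩_{e′}`),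
  **`comp_realRep_mem_orthogonal_hodgeSublattice`** (`f^* T′ ⊆ T`), **`image_pullbackAlt_orthogonal_hodgeSublattice_eq`** (`f^* T′ = T`).
* §2 **`IsIsomorphic.exists_middleHodgeLattice_transport`**, `IsIsomorphic.finrank_orthogonal_hodgeSublattice_eq`.
* §3 **`exists_isometryEquiv_of_realRep`** (`f^* ∈ O(H^{2p}(X, ℤ))` for `f ∈ Aut(X)`), **`map_hodgeSublattice_eq_of_comp_realRep`**,
  **`map_orthogonal_hodgeSublattice_eq_of_comp_realRep`**, **`exists_isometryEquiv_restrict_compat_of_realRep`** (`α = G|_{Hdg}`,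
  `β = G|_T`, `γ ∘ ᾱ = β̄ ∘ γ`), `IsRiemannForm.exists_isometryEquiv_restrict_compat_of_realRep`.

## References

* [cite: ShiodaMitani1974, §1 (1.5), §3 (3.19)]
* [cite: Lange2023AbelianVarietiesComplex, §1.1.2 Prop. 1.1.6; §1.1.6 Exercise (5)(b); §1.1.3 Exercise 1.1.6 (7); §1.7.2 Cor. 1.7.6; §6.2.4 (p. 310); §7.2.2]
* [cite: Huybrechts2016K3, Ch. 14 §0.2 Prop. 0.2 (ii) (PDF pp. 333–334); Ch. 3 §2.2–2.3]
* [cite: Nikulin1980, Cor. 1.5.2, Prop. 1.6.1]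
* [cite: Kondo2013K3Enriques, §2.10 Prop. 2.11, Cor. 2.14 (PDF pp. 128–129)]
-/

noncomputable section

set_option maxSynthPendingDepth 3

open Module Function
open LinearMap (BilinForm)

namespace Literature.Geometry.Kaehler.ComplexTorus

/-! ## §1 Two tori: `⟨f^*x, f^*y⟩_e = ± ⟨x, y⟩_{e′}` and `f^* T_{X′} = T_X` -/

section TwoTori

variable {ι ι' : Type*} [Fintype ι] [Fintype ι'] [DecidableEq ι] [DecidableEq ι']
  {E E' : Type*} [NormedAddCommGroup E] [NormedSpace ℂ E] [NormedAddCommGroup E'] [NormedSpace ℂ E']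
  (Φ : (ι → ℝ) ≃L[ℝ] E) (Φ' : (ι' → ℝ) ≃L[ℝ] E') {g p : ℕ} (e : Fin (2 * g) ≃ ι) (e' : Fin (2 * g) ≃ ι')
  (h : 2 * p + 2 * p = 2 * g)

/-- **`⟨f^*x, f^*y⟩_e = sign(e) sign(e′) · ⟨x, y⟩_{e′}`** for an isomorphism `f = ρ(A) : X ⥲ X′` of complex tori of dimension `2p`
(`A·A′ = 1`, `ρ(A)` `ℂ`-linear): the cup-product pairings of the middle cohomologies correspond under `f^*`, up to the sign comparing
the two chosen orientations (`⟨x, y⟩_e = sign(e) ∫_X x ∧ y` and `∫_X f^*x ∧ f^*y = ∫_{X′} x ∧ y`, the tree's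
`torusIntegral_comp_realRep_wedge`). [cite: ShiodaMitani1974, §1 (1.5)] [cite: Lange2023AbelianVarietiesComplex, §1.7.2 Cor. 1.7.6 (proof) and §6.2.4 (p. 310)] -/
theorem poincarePairing_comp_realRep_of_mul_eq_one {A : Matrix ι' ι ℤ} {A' : Matrix ι ι' ℤ} (hAA' : A * A' = 1)
    (hA : ∀ (c : ℂ) (u : E), realRep Φ Φ' A (c • u) = c • realRep Φ Φ' A u)
    (x y : E' [⋀^Fin (2 * p)]→L[ℝ] ℂ) :
    poincarePairing Φ e h (x.compContinuousLinearMap (realRep Φ Φ' A)) (y.compContinuousLinearMap (realRep Φ Φ' A)) =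
      ((orientationSign Φ ((finCongr h).trans e) * orientationSign Φ' ((finCongr h).trans e') : ℤ) : ℂ) *
        poincarePairing Φ' e' h x y := by
  rw [poincarePairing_eq_orientationSign_mul_torusIntegral_wedge,
    poincarePairing_eq_orientationSign_mul_torusIntegral_wedge Φ' e' h,
    torusIntegral_comp_realRep_wedge Φ Φ' hAA' hA ((finCongr h).trans e) ((finCongr h).trans e') x y]
  have hs' : (orientationSign Φ' ((finCongr h).trans e') : ℂ) * orientationSign Φ' ((finCongr h).trans e') = 1 := by
    exact_mod_cast orientationSign_mul_self Φ' ((finCongr h).trans e')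
  have key : (orientationSign Φ ((finCongr h).trans e) : ℂ) * orientationSign Φ' ((finCongr h).trans e') *
      ((orientationSign Φ' ((finCongr h).trans e') : ℂ) *
        torusIntegral Φ' ((finCongr h).trans e') (x.wedge y)) =
      orientationSign Φ ((finCongr h).trans e) * torusIntegral Φ' ((finCongr h).trans e') (x.wedge y) := by
    rw [mul_assoc, ← mul_assoc (orientationSign Φ' ((finCongr h).trans e') : ℂ), hs', one_mul]
  push_cast
  rw [key]

/-- **`f^* T_{X′} ⊆ T_X`** for an isomorphism `f = ρ(A) : X ⥲ X′` of tori of dimension `2p` (`A′A = AA′ = 1`, `ρ(A)`, `ρ(A′)` `ℂ`-linear):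
the pull-back of a transcendental integral class of `X′` is transcendental on `X` — it is integral, and for `s ∈ Hdgᵖ(X, ℤ)` one has
`s = f^*(ρ(A′)^* s)` with `ρ(A′)^* s ∈ Hdgᵖ(X′, ℤ)`, so `⟨s, f^*t⟩_e = ± ⟨ρ(A′)^*s, t⟩_{e′} = 0` (p18's `p = 1` statement is
`comp_realRep_mem_transcendentalLattice`). [cite: ShiodaMitani1974, §1 (1.5) and §3 (3.19)] [cite: Huybrechts2016K3, Ch. 3 §2.2–2.3] -/
theorem comp_realRep_mem_orthogonal_hodgeSublattice {A : Matrix ι' ι ℤ} {A' : Matrix ι ι' ℤ} (hA'A : A' * A = 1)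
    (hAA' : A * A' = 1) (hA : ∀ (c : ℂ) (u : E), realRep Φ Φ' A (c • u) = c • realRep Φ Φ' A u)
    (hA' : ∀ (c : ℂ) (u : E'), realRep Φ' Φ A' (c • u) = c • realRep Φ' Φ A' u)
    {B : BilinForm ℤ (integralForms Φ (2 * p))}
    (hB : ∀ x y : integralForms Φ (2 * p), ((B x y : ℤ) : ℂ) =
      poincarePairing Φ e h (x : E [⋀^Fin (2 * p)]→L[ℝ] ℂ) (y : E [⋀^Fin (2 * p)]→L[ℝ] ℂ))
    {B' : BilinForm ℤ (integralForms Φ' (2 * p))}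
    (hB' : ∀ x y : integralForms Φ' (2 * p), ((B' x y : ℤ) : ℂ) =
      poincarePairing Φ' e' h (x : E' [⋀^Fin (2 * p)]→L[ℝ] ℂ) (y : E' [⋀^Fin (2 * p)]→L[ℝ] ℂ))
    {t : integralForms Φ' (2 * p)}
    (ht : t ∈ B'.orthogonal (AddSubgroup.toIntSubmodule ((integralHodgeClasses Φ' p).addSubgroupOf (integralForms Φ' (2 * p))))) :
    (⟨(t : E' [⋀^Fin (2 * p)]→L[ℝ] ℂ).compContinuousLinearMap (realRep Φ Φ' A), comp_realRep_mem_integralForms Φ Φ' A t.2⟩ :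
        integralForms Φ (2 * p)) ∈
      B.orthogonal (AddSubgroup.toIntSubmodule ((integralHodgeClasses Φ p).addSubgroupOf (integralForms Φ (2 * p)))) := by
  rw [mem_orthogonal_hodgeSublattice_iff Φ e h hB]
  intro s hs
  have hs' := comp_realRep_mem_integralHodgeClasses Φ' Φ A' hA' hs
  have h0 := (mem_orthogonal_hodgeSublattice_iff Φ' e' h hB').1 ht _ hs'
  change poincarePairing Φ e h s ((t : E' [⋀^Fin (2 * p)]→L[ℝ] ℂ).compContinuousLinearMap (realRep Φ Φ' A)) = 0
  conv_lhs => rw [← compContinuousLinearMap_realRep_realRep Φ Φ' hA'A s]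
  rw [poincarePairing_comp_realRep_of_mul_eq_one Φ Φ' e e' h hAA' hA, h0, mul_zero]

/-- **`f^* T_{X′} = T_X`** (as subsets of `H^{2p}(X, ℂ)`) for an isomorphism `f = ρ(A) : X ⥲ X′` of complex tori of dimension `2p`:
the transcendental lattice is an isomorphism invariant in every codimension (with `f^* H^{2p}(X′, ℤ) = H^{2p}(X, ℤ)` and
`f^* Hdgᵖ(X′, ℤ) = Hdgᵖ(X, ℤ)`, p18's `map_pullbackAlt_integralForms_eq` / `map_pullbackAlt_integralHodgeClasses_eq`).
[cite: ShiodaMitani1974, §3 (3.19)] [cite: Huybrechts2016K3, Ch. 3 §2.2–2.3] -/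
theorem image_pullbackAlt_orthogonal_hodgeSublattice_eq {A : Matrix ι' ι ℤ} {A' : Matrix ι ι' ℤ} (hA'A : A' * A = 1)
    (hAA' : A * A' = 1) (hA : ∀ (c : ℂ) (u : E), realRep Φ Φ' A (c • u) = c • realRep Φ Φ' A u)
    (hA' : ∀ (c : ℂ) (u : E'), realRep Φ' Φ A' (c • u) = c • realRep Φ' Φ A' u)
    {B : BilinForm ℤ (integralForms Φ (2 * p))}
    (hB : ∀ x y : integralForms Φ (2 * p), ((B x y : ℤ) : ℂ) =
      poincarePairing Φ e h (x : E [⋀^Fin (2 * p)]→L[ℝ] ℂ) (y : E [⋀^Fin (2 * p)]→L[ℝ] ℂ))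
    {B' : BilinForm ℤ (integralForms Φ' (2 * p))}
    (hB' : ∀ x y : integralForms Φ' (2 * p), ((B' x y : ℤ) : ℂ) =
      poincarePairing Φ' e' h (x : E' [⋀^Fin (2 * p)]→L[ℝ] ℂ) (y : E' [⋀^Fin (2 * p)]→L[ℝ] ℂ)) :
    pullbackAlt (realRep Φ Φ' A) (2 * p) ''
        (Subtype.val '' (B'.orthogonal (AddSubgroup.toIntSubmodule
          ((integralHodgeClasses Φ' p).addSubgroupOf (integralForms Φ' (2 * p)))) : Set (integralForms Φ' (2 * p)))) =
      Subtype.val '' (B.orthogonal (AddSubgroup.toIntSubmodule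
        ((integralHodgeClasses Φ p).addSubgroupOf (integralForms Φ (2 * p)))) : Set (integralForms Φ (2 * p))) := by
  apply Set.Subset.antisymm
  · rintro _ ⟨_, ⟨t, ht, rfl⟩, rfl⟩
    exact ⟨_, comp_realRep_mem_orthogonal_hodgeSublattice Φ Φ' e e' h hA'A hAA' hA hA' hB hB' ht, rfl⟩
  · rintro _ ⟨t, ht, rfl⟩
    refine ⟨(t : E [⋀^Fin (2 * p)]→L[ℝ] ℂ).compContinuousLinearMap (realRep Φ' Φ A'),
      ⟨_, comp_realRep_mem_orthogonal_hodgeSublattice Φ' Φ e' e h hAA' hA'A hA' hA hB' hB ht, rfl⟩, ?_⟩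
    rw [pullbackAlt_apply, compContinuousLinearMap_realRep_realRep Φ Φ' hA'A]

end TwoTori

/-! ## §2 `X ≅ X′ ⟹ (H^{2p}(X′, ℤ), Hdgᵖ(X′, ℤ), T_{X′}, ⟨·,·⟩) ≅ (H^{2p}(X, ℤ), Hdgᵖ(X, ℤ), T_X, ⟨·,·⟩)` -/

section Invariance

variable {ι ι' : Type*} [Fintype ι] [Fintype ι'] [DecidableEq ι] [DecidableEq ι']
  {E E' : Type*} [NormedAddCommGroup E] [NormedSpace ℂ E] [NormedAddCommGroup E'] [NormedSpace ℂ E']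
  {Φ : (ι → ℝ) ≃L[ℝ] E} {Φ' : (ι' → ℝ) ≃L[ℝ] E'} {g p : ℕ}

/-- **THE MIDDLE HODGE LATTICE AND ITS TRANSCENDENTAL COMPLEMENT ARE ISOMORPHISM INVARIANTS** (Shioda–Mitani's map `g : X ↦ T_X` of
(3.19) is well defined, in every codimension): for isomorphic complex tori `X ≅ X′` of dimension `2p` there is an injective `ℂ`-linear
`Ψ : H^{2p}(X′, ℂ) → H^{2p}(X, ℂ)` (the pull-back `f^*` along an isomorphism) with `Ψ H^{2p}(X′, ℤ) = H^{2p}(X, ℤ)`,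
`Ψ Hdgᵖ(X′, ℤ) = Hdgᵖ(X, ℤ)`, `Ψ T_{X′} = T_X`, `∫_X Ψx ∧ Ψy = ∫_{X′} x ∧ y` and `⟨Ψx, Ψy⟩_e = sign(e)sign(e′) ⟨x, y⟩_{e′}`.
[cite: ShiodaMitani1974, §1 (1.5) and §3 (3.19)] [cite: Lange2023AbelianVarietiesComplex, §1.1.2 Prop. 1.1.6 and §1.1.6 Exercise (5)(b)] [cite: Huybrechts2016K3, Ch. 3 §2.2–2.3] -/
theorem IsIsomorphic.exists_middleHodgeLattice_transport (hiso : IsIsomorphic Φ Φ')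
    (e : Fin (2 * g) ≃ ι) (e' : Fin (2 * g) ≃ ι') (h : 2 * p + 2 * p = 2 * g)
    {B : BilinForm ℤ (integralForms Φ (2 * p))}
    (hB : ∀ x y : integralForms Φ (2 * p), ((B x y : ℤ) : ℂ) =
      poincarePairing Φ e h (x : E [⋀^Fin (2 * p)]→L[ℝ] ℂ) (y : E [⋀^Fin (2 * p)]→L[ℝ] ℂ))
    {B' : BilinForm ℤ (integralForms Φ' (2 * p))}
    (hB' : ∀ x y : integralForms Φ' (2 * p), ((B' x y : ℤ) : ℂ) =
      poincarePairing Φ' e' h (x : E' [⋀^Fin (2 * p)]→L[ℝ] ℂ) (y : E' [⋀^Fin (2 * p)]→L[ℝ] ℂ)) :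
    ∃ Ψ : (E' [⋀^Fin (2 * p)]→L[ℝ] ℂ) →ₗ[ℂ] (E [⋀^Fin (2 * p)]→L[ℝ] ℂ),
      Function.Injective Ψ ∧
      (integralForms Φ' (2 * p)).map Ψ.toAddMonoidHom = integralForms Φ (2 * p) ∧
      (integralHodgeClasses Φ' p).map Ψ.toAddMonoidHom = integralHodgeClasses Φ p ∧
      Ψ '' (Subtype.val '' (B'.orthogonal (AddSubgroup.toIntSubmodule
          ((integralHodgeClasses Φ' p).addSubgroupOf (integralForms Φ' (2 * p)))) : Set (integralForms Φ' (2 * p)))) =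
        Subtype.val '' (B.orthogonal (AddSubgroup.toIntSubmodule
          ((integralHodgeClasses Φ p).addSubgroupOf (integralForms Φ (2 * p)))) : Set (integralForms Φ (2 * p))) ∧
      (∀ x y : E' [⋀^Fin (2 * p)]→L[ℝ] ℂ,
        torusIntegral Φ ((finCongr h).trans e) ((Ψ x).wedge (Ψ y)) = torusIntegral Φ' ((finCongr h).trans e') (x.wedge y)) ∧
      ∀ x y : E' [⋀^Fin (2 * p)]→L[ℝ] ℂ,
        poincarePairing Φ e h (Ψ x) (Ψ y) =
          ((orientationSign Φ ((finCongr h).trans e) * orientationSign Φ' ((finCongr h).trans e') : ℤ) : ℂ) *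
            poincarePairing Φ' e' h x y := by
  obtain ⟨A, A', hA'A, hAA', hA, hA'⟩ := hiso.exists_matrix_smul
  refine ⟨pullbackAlt (realRep Φ Φ' A) (2 * p), fun x y hxy ↦ ?_, map_pullbackAlt_integralForms_eq Φ Φ' hA'A,
    map_pullbackAlt_integralHodgeClasses_eq (p := p) Φ Φ' hA'A hA hA',
    image_pullbackAlt_orthogonal_hodgeSublattice_eq Φ Φ' e e' h hA'A hAA' hA hA' hB hB',
    fun x y ↦ torusIntegral_comp_realRep_wedge Φ Φ' hAA' hA _ _ x y,
    fun x y ↦ poincarePairing_comp_realRep_of_mul_eq_one Φ Φ' e e' h hAA' hA x y⟩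
  have := congrArg (fun z : E [⋀^Fin (2 * p)]→L[ℝ] ℂ ↦ z.compContinuousLinearMap (realRep Φ' Φ A')) hxy
  simpa only [pullbackAlt_apply, compContinuousLinearMap_realRep_realRep Φ' Φ hAA'] using this

/-- **`rk T_X = rk T_{X′}` for isomorphic tori of dimension `2p`** (`rk T = C(2g, 2p) − ρ_p`, g30-#9, and `ρ_p(X) = ρ_p(X′)`, the tree's
`IsIsomorphic.finrank_hodgeClasses_eq`). [cite: ShiodaMitani1974, §3 (3.19)] [cite: Huybrechts2016K3, Ch. 3 §2.3 (PDF p. 59)] -/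
theorem IsIsomorphic.finrank_orthogonal_hodgeSublattice_eq (hiso : IsIsomorphic Φ Φ')
    (e : Fin (2 * g) ≃ ι) (e' : Fin (2 * g) ≃ ι') (h : 2 * p + 2 * p = 2 * g)
    {B : BilinForm ℤ (integralForms Φ (2 * p))}
    (hB : ∀ x y : integralForms Φ (2 * p), ((B x y : ℤ) : ℂ) =
      poincarePairing Φ e h (x : E [⋀^Fin (2 * p)]→L[ℝ] ℂ) (y : E [⋀^Fin (2 * p)]→L[ℝ] ℂ))
    {B' : BilinForm ℤ (integralForms Φ' (2 * p))}
    (hB' : ∀ x y : integralForms Φ' (2 * p), ((B' x y : ℤ) : ℂ) =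
      poincarePairing Φ' e' h (x : E' [⋀^Fin (2 * p)]→L[ℝ] ℂ) (y : E' [⋀^Fin (2 * p)]→L[ℝ] ℂ)) :
    finrank ℤ (B.orthogonal (AddSubgroup.toIntSubmodule ((integralHodgeClasses Φ p).addSubgroupOf (integralForms Φ (2 * p))))) =
      finrank ℤ (B'.orthogonal (AddSubgroup.toIntSubmodule
        ((integralHodgeClasses Φ' p).addSubgroupOf (integralForms Φ' (2 * p))))) := by
  rw [ComplexTorus.finrank_orthogonal_hodgeSublattice_eq Φ e h hB,
    ComplexTorus.finrank_orthogonal_hodgeSublattice_eq Φ' e' h hB', hiso.finrank_hodgeClasses_eq p]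

end Invariance

/-! ## §3 One torus: `Aut(X)` acts on `(H^{2p}(X, ℤ), B)` by isometries preserving `Hdg` and `T` -/

section Automorphisms

variable {ι : Type*} [Fintype ι] [DecidableEq ι] {E : Type*} [NormedAddCommGroup E] [NormedSpace ℂ E]
  (Φ : (ι → ℝ) ≃L[ℝ] E) {g p : ℕ} (e : Fin (2 * g) ≃ ι) (h : 2 * p + 2 * p = 2 * g)
  {A A' : Matrix ι ι ℤ}

/-- An isometry of a lattice mapping a sublattice `W` onto itself restricts to an isometry of `(W, B|_W)`. [folklore] -/
private theorem exists_isometryEquiv_restrict_of_map_eq {M : Type*} [AddCommGroup M] {B : BilinForm ℤ M}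
    (G : B.IsometryEquiv B) (W : Submodule ℤ M) (hW : W.map (G.toLinearEquiv : M →ₗ[ℤ] M) = W) :
    ∃ α : (B.restrict W).IsometryEquiv (B.restrict W), ∀ s : W, G (s : M) = α s := by
  refine ⟨{ toLinearEquiv := G.toLinearEquiv.ofSubmodules W W hW, map_app' := fun x y ↦ ?_ }, fun s ↦ ?_⟩
  · show B ((G.toLinearEquiv.ofSubmodules W W hW x : W) : M) ((G.toLinearEquiv.ofSubmodules W W hW y : W) : M) =
      B (x : M) (y : M)
    rw [LinearEquiv.ofSubmodules_apply, LinearEquiv.ofSubmodules_apply]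
    exact G.map_app y x
  · change G (s : M) = ((G.toLinearEquiv.ofSubmodules W W hW s : W) : M)
    rw [LinearEquiv.ofSubmodules_apply]
    rfl

/-- **`f^* ∈ O(H^{2p}(X, ℤ))` for an automorphism `f = ρ(A)` of the torus** (`A′A = AA′ = 1`, `ρ(A)` `ℂ`-linear): the pull-back is a
`ℤ`-linear automorphism `G` of the lattice `H^{2p}(X, ℤ)` (inverse `ρ(A′)^*`) which is an isometry of the cup form,
`B(Gx, Gy) = B(x, y)` (`⟨f^*x, f^*y⟩_e = sign(e)² ⟨x, y⟩_e`). [cite: ShiodaMitani1974, §1 (1.5)] [cite: Lange2023AbelianVarietiesComplex, §1.1.3 Exercise 1.1.6 (7) and §1.7.2 Cor. 1.7.6] -/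
theorem exists_isometryEquiv_of_realRep (hA'A : A' * A = 1) (hAA' : A * A' = 1)
    (hA : ∀ (c : ℂ) (u : E), realRep Φ Φ A (c • u) = c • realRep Φ Φ A u)
    {B : BilinForm ℤ (integralForms Φ (2 * p))}
    (hB : ∀ x y : integralForms Φ (2 * p), ((B x y : ℤ) : ℂ) =
      poincarePairing Φ e h (x : E [⋀^Fin (2 * p)]→L[ℝ] ℂ) (y : E [⋀^Fin (2 * p)]→L[ℝ] ℂ)) :
    ∃ G : B.IsometryEquiv B, ∀ x : integralForms Φ (2 * p),
      ((G x : integralForms Φ (2 * p)) : E [⋀^Fin (2 * p)]→L[ℝ] ℂ) =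
        (x : E [⋀^Fin (2 * p)]→L[ℝ] ℂ).compContinuousLinearMap (realRep Φ Φ A) := by
  let F : integralForms Φ (2 * p) ≃+ integralForms Φ (2 * p) :=
    { toFun := fun x ↦ ⟨(x : E [⋀^Fin (2 * p)]→L[ℝ] ℂ).compContinuousLinearMap (realRep Φ Φ A),
        comp_realRep_mem_integralForms Φ Φ A x.2⟩
      invFun := fun x ↦ ⟨(x : E [⋀^Fin (2 * p)]→L[ℝ] ℂ).compContinuousLinearMap (realRep Φ Φ A'),
        comp_realRep_mem_integralForms Φ Φ A' x.2⟩
      left_inv := fun x ↦ Subtype.ext (compContinuousLinearMap_realRep_realRep Φ Φ hAA' _)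
      right_inv := fun x ↦ Subtype.ext (compContinuousLinearMap_realRep_realRep Φ Φ hA'A _)
      map_add' := fun x y ↦ Subtype.ext ((pullbackAlt (realRep Φ Φ A) (2 * p)).map_add _ _) }
  refine ⟨{ toLinearEquiv := F.toIntLinearEquiv, map_app' := fun x y ↦ ?_ }, fun x ↦ rfl⟩
  apply Int.cast_injective (α := ℂ)
  change (((B (F x) (F y) : ℤ) : ℂ)) = ((B x y : ℤ) : ℂ)
  rw [hB, hB]
  change poincarePairing Φ e h ((x : E [⋀^Fin (2 * p)]→L[ℝ] ℂ).compContinuousLinearMap (realRep Φ Φ A))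
      ((y : E [⋀^Fin (2 * p)]→L[ℝ] ℂ).compContinuousLinearMap (realRep Φ Φ A)) = _
  rw [poincarePairing_comp_realRep_of_mul_eq_one Φ Φ e e h hAA' hA, orientationSign_mul_self, Int.cast_one, one_mul]

/-- **`f^* Hdgᵖ(X, ℤ) = Hdgᵖ(X, ℤ)` inside `H^{2p}(X, ℤ)` for an automorphism `f = ρ(A)`**: any `ℤ`-linear endomorphism `F` of the
lattice acting as `x ↦ x ∘ ρ(A)` (`A′A = 1`, `ρ(A)`, `ρ(A′)` `ℂ`-linear) maps the Hodge sublattice ONTO itself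
(`f^*`, `(f⁻¹)^*` preserve integral Hodge classes). [cite: Lange2023AbelianVarietiesComplex, §7.2.2 and §7.3.3 Exercise (1)] -/
theorem map_hodgeSublattice_eq_of_comp_realRep (hA'A : A' * A = 1)
    (hA : ∀ (c : ℂ) (u : E), realRep Φ Φ A (c • u) = c • realRep Φ Φ A u)
    (hA' : ∀ (c : ℂ) (u : E), realRep Φ Φ A' (c • u) = c • realRep Φ Φ A' u)
    (F : integralForms Φ (2 * p) →ₗ[ℤ] integralForms Φ (2 * p))
    (hF : ∀ x : integralForms Φ (2 * p), ((F x : integralForms Φ (2 * p)) : E [⋀^Fin (2 * p)]→L[ℝ] ℂ) =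
      (x : E [⋀^Fin (2 * p)]→L[ℝ] ℂ).compContinuousLinearMap (realRep Φ Φ A)) :
    (AddSubgroup.toIntSubmodule ((integralHodgeClasses Φ p).addSubgroupOf (integralForms Φ (2 * p)))).map F =
      AddSubgroup.toIntSubmodule ((integralHodgeClasses Φ p).addSubgroupOf (integralForms Φ (2 * p))) := by
  apply le_antisymm
  · rintro _ ⟨x, hx, rfl⟩
    rw [SetLike.mem_coe, mem_hodgeSublattice_iff] at hx
    rw [mem_hodgeSublattice_iff, hF]
    exact comp_realRep_mem_integralHodgeClasses Φ Φ A hA hx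
  · intro y hy
    rw [mem_hodgeSublattice_iff] at hy
    refine ⟨⟨(y : E [⋀^Fin (2 * p)]→L[ℝ] ℂ).compContinuousLinearMap (realRep Φ Φ A'),
      comp_realRep_mem_integralForms Φ Φ A' y.2⟩, ?_, ?_⟩
    · rw [SetLike.mem_coe, mem_hodgeSublattice_iff]
      exact comp_realRep_mem_integralHodgeClasses Φ Φ A' hA' hy
    · apply Subtype.ext
      rw [hF]
      exact compContinuousLinearMap_realRep_realRep Φ Φ hA'A _

/-- **`f^* T = T` for an automorphism `f = ρ(A)` of a torus of dimension `2p`**: `F : x ↦ x ∘ ρ(A)` maps the transcendental lattice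
`T = Hdg^⊥` ONTO itself (§1 with `X′ = X`). [cite: ShiodaMitani1974, §1 (1.5) and §3 (3.19)] [cite: Huybrechts2016K3, Ch. 3 §2.2–2.3] -/
theorem map_orthogonal_hodgeSublattice_eq_of_comp_realRep (hA'A : A' * A = 1) (hAA' : A * A' = 1)
    (hA : ∀ (c : ℂ) (u : E), realRep Φ Φ A (c • u) = c • realRep Φ Φ A u)
    (hA' : ∀ (c : ℂ) (u : E), realRep Φ Φ A' (c • u) = c • realRep Φ Φ A' u)
    {B : BilinForm ℤ (integralForms Φ (2 * p))}
    (hB : ∀ x y : integralForms Φ (2 * p), ((B x y : ℤ) : ℂ) =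
      poincarePairing Φ e h (x : E [⋀^Fin (2 * p)]→L[ℝ] ℂ) (y : E [⋀^Fin (2 * p)]→L[ℝ] ℂ))
    (F : integralForms Φ (2 * p) →ₗ[ℤ] integralForms Φ (2 * p))
    (hF : ∀ x : integralForms Φ (2 * p), ((F x : integralForms Φ (2 * p)) : E [⋀^Fin (2 * p)]→L[ℝ] ℂ) =
      (x : E [⋀^Fin (2 * p)]→L[ℝ] ℂ).compContinuousLinearMap (realRep Φ Φ A)) :
    (B.orthogonal (AddSubgroup.toIntSubmodule ((integralHodgeClasses Φ p).addSubgroupOf (integralForms Φ (2 * p))))).map F =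
      B.orthogonal (AddSubgroup.toIntSubmodule ((integralHodgeClasses Φ p).addSubgroupOf (integralForms Φ (2 * p)))) := by
  apply le_antisymm
  · rintro _ ⟨t, ht, rfl⟩
    have h1 := comp_realRep_mem_orthogonal_hodgeSublattice Φ Φ e e h hA'A hAA' hA hA' hB hB ht
    have h2 : F t = ⟨(t : E [⋀^Fin (2 * p)]→L[ℝ] ℂ).compContinuousLinearMap (realRep Φ Φ A),
        comp_realRep_mem_integralForms Φ Φ A t.2⟩ := Subtype.ext (hF t)
    rw [h2]
    exact h1
  · intro t ht
    refine ⟨⟨(t : E [⋀^Fin (2 * p)]→L[ℝ] ℂ).compContinuousLinearMap (realRep Φ Φ A'),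
      comp_realRep_mem_integralForms Φ Φ A' t.2⟩,
      comp_realRep_mem_orthogonal_hodgeSublattice Φ Φ e e h hAA' hA'A hA' hA hB hB ht, ?_⟩
    apply Subtype.ext
    rw [hF]
    exact compContinuousLinearMap_realRep_realRep Φ Φ hA'A _

/-- **The action of `Aut(X)` on `Hdgᵖ(X, ℤ)` and on `T` is compatible on the discriminant groups**: for an automorphism `f = ρ(A)` of a
torus of dimension `2p` whose Hodge lattice is non-degenerate, `f^*` is an isometry `G` of `H^{2p}(X, ℤ)` restricting to isometries
`α` of `Hdg = Hdgᵖ(X, ℤ)` and `β` of `T = Hdg^⊥`, and the automorphisms `ᾱ ∈ O(A_{Hdg})`, `β̄ ∈ O(A_T)` they induce satisfy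
`γ ∘ ᾱ = β̄ ∘ γ` for Kondō's `γ = p_T ∘ p_S⁻¹ : A_{Hdg} ⥲ A_T` (Nikulin Cor. 1.5.2 / Huybrechts Prop. 0.2 (ii) for the isometry `G`
of the unimodular overlattice `H ⊃ Hdg ⊕ T`; the tree's `exists_isometryEquiv_middle_extends_iff`, direction `⇒`).
[cite: Nikulin1980, Cor. 1.5.2, Prop. 1.6.1] [cite: Kondo2013K3Enriques, §2.10 Prop. 2.11 (PDF p. 128)] [cite: Huybrechts2016K3, Ch. 14 §0.2 Prop. 0.2 (ii) (PDF pp. 333–334)] -/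
theorem exists_isometryEquiv_restrict_compat_of_realRep [Module.Finite ℤ (integralForms Φ (2 * p))]
    [Module.Free ℤ (integralForms Φ (2 * p))] (hA'A : A' * A = 1) (hAA' : A * A' = 1)
    (hA : ∀ (c : ℂ) (u : E), realRep Φ Φ A (c • u) = c • realRep Φ Φ A u)
    (hA' : ∀ (c : ℂ) (u : E), realRep Φ Φ A' (c • u) = c • realRep Φ Φ A' u)
    {B : BilinForm ℤ (integralForms Φ (2 * p))} [B.IsPerfPair]
    (hB : ∀ x y : integralForms Φ (2 * p), ((B x y : ℤ) : ℂ) =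
      poincarePairing Φ e h (x : E [⋀^Fin (2 * p)]→L[ℝ] ℂ) (y : E [⋀^Fin (2 * p)]→L[ℝ] ℂ))
    (hnd : (B.restrict (AddSubgroup.toIntSubmodule
      ((integralHodgeClasses Φ p).addSubgroupOf (integralForms Φ (2 * p))))).Nondegenerate) :
    ∃ (G : B.IsometryEquiv B)
      (α : (B.restrict (AddSubgroup.toIntSubmodule ((integralHodgeClasses Φ p).addSubgroupOf (integralForms Φ (2 * p))))).IsometryEquiv
        (B.restrict (AddSubgroup.toIntSubmodule ((integralHodgeClasses Φ p).addSubgroupOf (integralForms Φ (2 * p))))))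
      (β : (B.restrict (B.orthogonal (AddSubgroup.toIntSubmodule
          ((integralHodgeClasses Φ p).addSubgroupOf (integralForms Φ (2 * p)))))).IsometryEquiv
        (B.restrict (B.orthogonal (AddSubgroup.toIntSubmodule
          ((integralHodgeClasses Φ p).addSubgroupOf (integralForms Φ (2 * p))))))),
      (∀ x : integralForms Φ (2 * p), ((G x : integralForms Φ (2 * p)) : E [⋀^Fin (2 * p)]→L[ℝ] ℂ) =
        (x : E [⋀^Fin (2 * p)]→L[ℝ] ℂ).compContinuousLinearMap (realRep Φ Φ A)) ∧
      (∀ s : AddSubgroup.toIntSubmodule ((integralHodgeClasses Φ p).addSubgroupOf (integralForms Φ (2 * p))),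
        G (s : integralForms Φ (2 * p)) = α s) ∧
      (∀ t : B.orthogonal (AddSubgroup.toIntSubmodule ((integralHodgeClasses Φ p).addSubgroupOf (integralForms Φ (2 * p)))),
        G (t : integralForms Φ (2 * p)) = β t) ∧
      ∀ a, B.discriminantGroupEquiv _ (isSymm_of_eq_poincarePairing_middle Φ e h (even_two_mul p) hB)
          (fun _ _ hk hx ↦ mem_hodgeSublattice_of_smul_mem Φ hk hx) (α.discriminantGroupCongr a) =
        β.discriminantGroupCongr (B.discriminantGroupEquiv _ (isSymm_of_eq_poincarePairing_middle Φ e h (even_two_mul p) hB)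
          (fun _ _ hk hx ↦ mem_hodgeSublattice_of_smul_mem Φ hk hx) a) := by
  -- (`obtain` on this goal runs into an `isDefEq` timeout; eliminate the existential by hand)
  refine (exists_isometryEquiv_of_realRep Φ e h hA'A hAA' hA hB).elim fun G hG ↦ ?_
  have hmapS := map_hodgeSublattice_eq_of_comp_realRep Φ (p := p) hA'A hA hA'
    (G.toLinearEquiv : integralForms Φ (2 * p) →ₗ[ℤ] integralForms Φ (2 * p)) hG
  have hmapT := map_orthogonal_hodgeSublattice_eq_of_comp_realRep Φ e h hA'A hAA' hA hA' hB
    (G.toLinearEquiv : integralForms Φ (2 * p) →ₗ[ℤ] integralForms Φ (2 * p)) hG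
  refine (exists_isometryEquiv_restrict_of_map_eq G _ hmapS).elim fun α hα ↦ ?_
  refine (exists_isometryEquiv_restrict_of_map_eq G _ hmapT).elim fun β hβ ↦ ?_
  exact ⟨G, α, β, hG, hα, hβ, (exists_isometryEquiv_middle_extends_iff Φ e h Φ e hB hB hnd hnd α β).1 ⟨G, hα, hβ⟩⟩

/-- **The same on an abelian variety of dimension `2p`** (`IsRiemannForm Φ η`: the Hodge lattice is non-degenerate, g30-#4, and
`H^{2p}(X, ℤ)` is unimodular, g30-#1): every automorphism `f = ρ(A)` induces an isometry of `H^{2p}(X, ℤ)` whose restrictions to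
`Hdgᵖ(X, ℤ)` and to the transcendental lattice act compatibly (`γ ∘ ᾱ = β̄ ∘ γ`) on the discriminant groups.
[cite: Nikulin1980, Cor. 1.5.2, Prop. 1.6.1] [cite: Huybrechts2016K3, Ch. 14 §0.2 Prop. 0.2 (ii) (PDF pp. 333–334)] [cite: Lange2023AbelianVarietiesComplex, §7.2.2] -/
theorem IsRiemannForm.exists_isometryEquiv_restrict_compat_of_realRep [FiniteDimensional ℂ E]
    [Module.Finite ℤ (integralForms Φ (2 * p))] [Module.Free ℤ (integralForms Φ (2 * p))]
    {η : E [⋀^Fin 2]→L[ℝ] ℝ} (hη : IsRiemannForm Φ η) (hA'A : A' * A = 1) (hAA' : A * A' = 1)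
    (hA : ∀ (c : ℂ) (u : E), realRep Φ Φ A (c • u) = c • realRep Φ Φ A u)
    (hA' : ∀ (c : ℂ) (u : E), realRep Φ Φ A' (c • u) = c • realRep Φ Φ A' u)
    {B : BilinForm ℤ (integralForms Φ (2 * p))} [B.IsPerfPair]
    (hB : ∀ x y : integralForms Φ (2 * p), ((B x y : ℤ) : ℂ) =
      poincarePairing Φ e h (x : E [⋀^Fin (2 * p)]→L[ℝ] ℂ) (y : E [⋀^Fin (2 * p)]→L[ℝ] ℂ)) :
    ∃ (G : B.IsometryEquiv B)
      (α : (B.restrict (AddSubgroup.toIntSubmodule ((integralHodgeClasses Φ p).addSubgroupOf (integralForms Φ (2 * p))))).IsometryEquiv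
        (B.restrict (AddSubgroup.toIntSubmodule ((integralHodgeClasses Φ p).addSubgroupOf (integralForms Φ (2 * p))))))
      (β : (B.restrict (B.orthogonal (AddSubgroup.toIntSubmodule
          ((integralHodgeClasses Φ p).addSubgroupOf (integralForms Φ (2 * p)))))).IsometryEquiv
        (B.restrict (B.orthogonal (AddSubgroup.toIntSubmodule
          ((integralHodgeClasses Φ p).addSubgroupOf (integralForms Φ (2 * p))))))),
      (∀ x : integralForms Φ (2 * p), ((G x : integralForms Φ (2 * p)) : E [⋀^Fin (2 * p)]→L[ℝ] ℂ) =
        (x : E [⋀^Fin (2 * p)]→L[ℝ] ℂ).compContinuousLinearMap (realRep Φ Φ A)) ∧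
      (∀ s : AddSubgroup.toIntSubmodule ((integralHodgeClasses Φ p).addSubgroupOf (integralForms Φ (2 * p))),
        G (s : integralForms Φ (2 * p)) = α s) ∧
      (∀ t : B.orthogonal (AddSubgroup.toIntSubmodule ((integralHodgeClasses Φ p).addSubgroupOf (integralForms Φ (2 * p)))),
        G (t : integralForms Φ (2 * p)) = β t) ∧
      ∀ a, B.discriminantGroupEquiv _ (isSymm_of_eq_poincarePairing_middle Φ e h (even_two_mul p) hB)
          (fun _ _ hk hx ↦ mem_hodgeSublattice_of_smul_mem Φ hk hx) (α.discriminantGroupCongr a) =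
        β.discriminantGroupCongr (B.discriminantGroupEquiv _ (isSymm_of_eq_poincarePairing_middle Φ e h (even_two_mul p) hB)
          (fun _ _ hk hx ↦ mem_hodgeSublattice_of_smul_mem Φ hk hx) a) :=
  ComplexTorus.exists_isometryEquiv_restrict_compat_of_realRep Φ e h hA'A hAA' hA hA' hB
    (hη.nondegenerate_restrict_hodgeSublattice Φ e h hB)

end Automorphisms

end Literature.Geometry.Kaehler.ComplexTorus
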